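import Literature.Topology.FourManifolds.KhTriangleBlocks
import Literature.Topology.FourManifolds.KhLoopSquareElim
import HarnessLib

/-!
# The third Reidemeister move: the cross blocks of the reduced complexes

Sibling file of `KhComplex.lean`, continuing `KhTriangleBlocks.lean`. The reduced differential
`loopM` (`KhLoopSquareElim.lean`) of a side of the third move has, besides the entries of `d`
between rest states, the correction term `- Σₐ ⟨d r, embO a X⟩ · sgn · ⟨d a, r'⟩` from the layer
`z = 0` into the sector `D₁`. This file computes these **cross blocks** on both sides and proves
that they correspond under `toG'` up to the gauge:

* `cross_sign` — the sign identity `sgn((0,0,1)ρ, x) sgn((1,0,0)ρ, z) sgn((0,1,0)ρ, z) sgn((0,0,1)ρ, y) = κ`;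
* `incidence_zsplit_G` / `incidence_zsplit_G'` — the entry of `d` from a `(1,0,0)`-state into
  the loop sector with the small circle labelled `X` is the Koszul sign times the indicator that
  the labels off the triangle agree (the column `(-) ⊗ X` of `Δ`);
* `aOf` / `aOf'` — the unique `A`-state with prescribed labels off the triangle, and the
  collapse of the correction sums to one term;
* `cross_b`, `cross_a` — **the two cross identities** ((**) and (*) of the notes): a plain
  `z`-saddle on one side equals the correction term on the other, up to the gauge.

No named fact is introduced.

## References

* M. Khovanov, *A categorification of the Jones polynomial*, Duke Math. J. 101 (2000) 359–426,
  §5.4. [cite: Khovanov2000, §5.4]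
* D. Bar-Natan, *On Khovanov's categorification of the Jones polynomial*, Algebr. Geom. Topol. 2
  (2002) 337–370, §4.4 (invariance under `Ω3`: `d ∘ F = d` on the layer of the moving crossing).
  [cite: BarNatan2002, §4]
-/

open Function Finset

noncomputable section

namespace Literature.Topology.FourManifolds

namespace GaussDiagram

open LocArc

/-! ## The sign identity of the cross blocks -/

section Sign

variable {G : GaussDiagram} {x y z : Fin G.n}

/-- **The sign identity of the cross blocks.** For a state `σ` with `(σ x, σ y, σ z) = (1, 0, 0)`,
the states `σ₂ = σ ∘ (x y)` (`(0,1,0)`) and `α = σ[x ↦ 0][z ↦ 1]` (`(0,0,1)`):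
`sgn(α, x) · sgn(σ, z) · sgn(σ₂, z) · sgn(α, y) = koszulXY x y σ`. [cite: Khovanov2000, §5.4] -/
theorem cross_sign (hxy : x ≠ y) (hxz : x ≠ z) (hyz : y ≠ z) (σ : G.State)
    (hσx : σ x = true) (hσy : σ y = false) (hσz : σ z = false) :
    edgeSign (Function.update (Function.update σ x false) z true) x * edgeSign σ z *
      edgeSign (σ ∘ Equiv.swap x y) z * edgeSign (Function.update (Function.update σ x false) z true) y =
      koszulXY x y σ := by
  set α := Function.update (Function.update σ x false) z true with hα
  have αx : α x = false := by rw [hα, Function.update_of_ne hxz, Function.update_self]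
  have αy : α y = false := by rw [hα, Function.update_of_ne hyz, Function.update_of_ne hxy.symm, hσy]
  have αz : α z = true := by rw [hα, Function.update_self]
  have αj : ∀ j, j ≠ x → j ≠ z → α j = σ j := fun j hjx hjz ↦ by
    rw [hα, Function.update_of_ne hjz, Function.update_of_ne hjx]
  have s2x : (σ ∘ Equiv.swap x y) x = false := by simp [hσy]
  have s2y : (σ ∘ Equiv.swap x y) y = true := by simp [hσx]
  have s2j : ∀ j, j ≠ x → j ≠ y → (σ ∘ Equiv.swap x y) j = σ j := fun j hjx hjy ↦ by
    simp [Equiv.swap_apply_of_ne_of_ne hjx hjy]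
  -- everything as products over the chords
  have hk : koszulXY x y σ = btwSgn x y σ := by
    unfold koszulXY; rw [hσx, hσy]; simp
  rw [hk, edgeSign_eq_prod_bsgn, edgeSign_eq_prod_bsgn, edgeSign_eq_prod_bsgn, edgeSign_eq_prod_bsgn]
  unfold btwSgn
  rw [← Finset.prod_mul_distrib, ← Finset.prod_mul_distrib, ← Finset.prod_mul_distrib]
  -- split off the factors at `x`, `y`, `z`
  have hyx : y ≠ x := hxy.symm
  have hzx : z ≠ x := hxz.symm
  have hzy : z ≠ y := hyz.symm
  rw [← Finset.mul_prod_erase _ _ (Finset.mem_univ x), ← Finset.mul_prod_erase univ _ (Finset.mem_univ x),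
    ← Finset.mul_prod_erase _ _ (Finset.mem_erase.2 ⟨hyx, Finset.mem_univ y⟩),
    ← Finset.mul_prod_erase (univ.erase x) _ (Finset.mem_erase.2 ⟨hyx, Finset.mem_univ y⟩),
    ← Finset.mul_prod_erase _ _ (Finset.mem_erase.2 ⟨hzy, Finset.mem_erase.2 ⟨hzx, Finset.mem_univ z⟩⟩),
    ← Finset.mul_prod_erase ((univ.erase x).erase y) _
      (Finset.mem_erase.2 ⟨hzy, Finset.mem_erase.2 ⟨hzx, Finset.mem_univ z⟩⟩)]
  have hxyz : ∀ j ∈ (((univ.erase x).erase y).erase z), j ≠ x ∧ j ≠ y ∧ j ≠ z := fun j hj ↦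
    ⟨(Finset.mem_erase.1 (Finset.mem_erase.1 (Finset.mem_erase.1 hj).2).2).1,
      (Finset.mem_erase.1 (Finset.mem_erase.1 hj).2).1, (Finset.mem_erase.1 hj).1⟩
  have hrest : ∏ j ∈ ((univ.erase x).erase y).erase z,
      ((if j < x then bsgn (α j) else 1) * (if j < z then bsgn (σ j) else 1) *
        (if j < z then bsgn ((σ ∘ Equiv.swap x y) j) else 1) * (if j < y then bsgn (α j) else 1)) =
      ∏ j ∈ ((univ.erase x).erase y).erase z, (if (x < j ∧ j < y) ∨ (y < j ∧ j < x) then bsgn (σ j) else 1) := by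
    refine Finset.prod_congr rfl fun j hj ↦ ?_
    obtain ⟨hjx, hjy, hjz⟩ := hxyz j hj
    rw [αj j hjx hjz, s2j j hjx hjy]
    rw [show ∀ a b c d : ℤ, a * b * c * d = (a * d) * (b * c) from fun a b c d ↦ by ring,
      ite_bsgn_mul_ite_bsgn, ite_bsgn_mul_ite_bsgn, if_neg (by simp : ¬¬(j < z ↔ j < z)), mul_one]
    have hjx' : (j : ℕ) ≠ x := fun h ↦ hjx (Fin.ext h)
    have hjy' : (j : ℕ) ≠ y := fun h ↦ hjy (Fin.ext h)
    have e : (¬ (j < x ↔ j < y)) ↔ ((x < j ∧ j < y) ∨ (y < j ∧ j < x)) := by simp only [Fin.lt_def]; omega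
    by_cases hc : (x < j ∧ j < y) ∨ (y < j ∧ j < x)
    · rw [if_pos hc, if_pos (e.2 hc)]
    · rw [if_neg hc, if_neg (fun h ↦ hc (e.1 h))]
  rw [hrest, αx, αy, αz, s2x, s2y, hσx, hσy, hσz]
  have hxz' : (x : ℕ) ≠ z := fun h ↦ hxz (Fin.ext h)
  have hyz' : (y : ℕ) ≠ z := fun h ↦ hyz (Fin.ext h)
  have hxy' : (x : ℕ) ≠ y := fun h ↦ hxy (Fin.ext h)
  have g1 : ¬ ((x < x ∧ x < y) ∨ (y < x ∧ x < x)) := by simp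
  have g2 : ¬ ((x < y ∧ y < y) ∨ (y < y ∧ y < x)) := by simp
  rw [if_neg g1, if_neg g2, if_neg (lt_irrefl x), if_neg (lt_irrefl z), if_neg (lt_irrefl z)]
  simp only [bsgn_true, bsgn_false, mul_one, one_mul, ite_self]
  -- the remaining signs at `x`, `y`, `z`
  by_cases h1 : x < z <;> by_cases h2 : y < z <;> by_cases h3 : z < x <;> by_cases h4 : z < y <;>
    simp only [h1, h2, h3, h4, ↓reduceIte, mul_one, one_mul, mul_neg, neg_mul, neg_neg] <;>
    (simp only [Fin.lt_def] at h1 h2 h3 h4; first | rfl | omega)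

end Sign




/-! ## The `z`-flip into the loop sector -/

section ZSplit

variable (G : GaussDiagram) {x y z : Fin G.n}
variable (hxz : x ≠ z) (ha : (G.overPos y : ℕ) = G.overPos x + 1) (hb : (G.overPos z : ℕ) = G.underPos x + 1)
  (hc : (G.underPos z : ℕ) = G.underPos y + 1) (hx : G.sign x = 1) (hy : G.sign y = 1) (hz : G.sign z = 1)

/-- The column `(-) ⊗ X` of the comultiplication table is the identity (split strand second).
[folklore] -/
theorem splitCoeff_mid_true {R : Type} [CommRing R] (hR tR : R) (ℓ w : Bool) :
    splitCoeff R hR tR ℓ true w = if w = ℓ then 1 else 0 := by cases ℓ <;> cases w <;> rfl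

/-- The column `X ⊗ (-)` of the comultiplication table is the identity (split strand first).
[folklore] -/
theorem splitCoeff_right_true {R : Type} [CommRing R] (hR tR : R) (ℓ v : Bool) :
    splitCoeff R hR tR ℓ v true = if v = ℓ then 1 else 0 := by cases ℓ <;> cases v <;> rfl

include hxz ha hb hc hx hy hz in
/-- **Flipping `z` from a `(1, 0, 0)`-state of `G` is a split** (the small circle splits off).
[cite: Khovanov2000, §5.4] -/
theorem isSplitAt_z_G {σ : G.State} (hσx : σ x = true) (hσy : σ y = false) (hσz : σ z = false) :
    G.IsSplitAt σ z := by
  refine ⟨hσz, ?_⟩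
  rw [G.arcIn_overPos_z hb]
  have h1 : Function.update σ z true x = true := by rw [Function.update_of_ne hxz]; exact hσx
  have h2 : Function.update σ z true y = false := by rw [Function.update_of_ne (G.y_ne_z hc)]; exact hσy
  exact G.circleOf_ne_of_inT hxz ha hb hc hx hy hz h1 h2 (Function.update_self ..) G.inT_sideB
    (G.not_inT_outB (y := y) hxz)

include hxz ha hb hc hx hy hz in
/-- **Flipping `z` from a `(1, 0, 0)`-state of the rearrangement is a split.** [cite: Khovanov2000, §5.4] -/
theorem isSplitAt_z_G' {σ : G.State} (hσx : σ x = true) (hσy : σ y = false) (hσz : σ z = false) :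
    (G.braidMove x y z).IsSplitAt σ z := by
  refine ⟨hσz, ?_⟩
  rw [G.overPos_braidMove_z, arcIn_braidMove, arcOut_braidMove]
  have h1 : Function.update σ z true x = true := by rw [Function.update_of_ne hxz]; exact hσx
  have h2 : Function.update σ z true y = false := by rw [Function.update_of_ne (G.y_ne_z hc)]; exact hσy
  exact (G.circleOf_braidMove_ne_of_inT hxz ha hb hc hx hy hz h1 h2 (Function.update_self ..) G.inT_sideB
    (G.not_inT_inB hxz ha hb hc)).symm

include hxz ha hb hc hx hy hz in
/-- Off the loop sector of `G` every arc reaches an arc off the triangle. [folklore] -/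
theorem exists_notInT_reach_bits_G {σ : G.State} (h : (σ x, σ y, σ z) ≠ (true, false, true)) (c : G.Arc) :
    ∃ e, ¬ G.InT x y e ∧ (G.stateGraph σ).Reachable c e := by
  by_cases hu : G.InT x y c
  · obtain ⟨a, -, rfl⟩ := G.exists_locArc_of_inT (z := z) hu
    refine ⟨G.locArc x y z (attach (locEdgesG (σ x) (σ y) (σ z)) a), ?_, ?_⟩
    · rw [G.inT_locArc_iff hxz ha hb hc]; exact not_isSide_attach (attachOK_G _ _ _ h)
    · exact G.reachable_of_locGraph_reachable _ (fun _ he ↦ G.reachable_locArc_of_mem ha hb hc hx hy hz σ he)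
        (locGraph_reachable_attach (attachOK_G _ _ _ h) a)
  · exact ⟨c, hu, .refl _⟩

include hxz ha hb hc hx hy hz in
/-- Off the loop sector of the rearrangement every arc reaches an arc off the triangle. [folklore] -/
theorem exists_notInT_reach_bits_G' {σ : G.State} (h : (σ x, σ y, σ z) ≠ (true, false, true)) (c : G.Arc) :
    ∃ e, ¬ G.InT x y e ∧ ((G.braidMove x y z).stateGraph σ).Reachable c e := by
  by_cases hu : G.InT x y c
  · obtain ⟨a, -, rfl⟩ := G.exists_locArc_of_inT (z := z) hu
    refine ⟨G.locArc x y z (attach (locEdgesG' (σ x) (σ y) (σ z)) a), ?_, ?_⟩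
    · rw [G.inT_locArc_iff hxz ha hb hc]; exact not_isSide_attach (attachOK_G' _ _ _ h)
    · exact G.reachable_of_locGraph_reachable _
        (fun _ he ↦ G.reachable_braidMove_locArc_of_mem hxz ha hb hc hx hy hz σ he)
        (locGraph_reachable_attach (attachOK_G' _ _ _ h) a)
  · exact ⟨c, hu, .refl _⟩

/-- **Two enhanced states over one state, agreeing off the triangle, are equal** when every arc
reaches an arc off the triangle. [folklore] -/
theorem ext_of_notInT {K : GaussDiagram} (NS : K.Arc → Prop) {s t : K.EnhancedState} (hst : s.state = t.state)
    (hreach : ∀ c, ∃ e, NS e ∧ (K.stateGraph s.state).Reachable c e) (hl : ∀ c, NS c → s.label c = t.label c) :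
    s = t := by
  refine EnhancedState.ext' hst (funext fun c ↦ ?_)
  obtain ⟨e, he, hce⟩ := hreach c
  rw [s.label_eq_of_reachable hce, hl e he, ← t.label_eq_of_reachable]
  rwa [← hst]

/-! ### The transported `A`-state of `G` -/

include hxz ha hb hc hx hy hz in
/-- **The `A`-state of `G` carrying the labels of a `(1, 0, 0)`-state `r`** (off the triangle):
state `r.state[x ↦ 0][z ↦ 1]`, labels read through the transfer `G(0,0,1) → G(1,0,0)`.
[cite: Khovanov2000, §5.4] -/
def aOf (r : G.EnhancedState) (hr : r.state x = true ∧ r.state y = false ∧ r.state z = false) :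
    (G.triLoopSq hxz ha hb hc hx hy hz).XA :=
  ⟨{ state := Function.update (Function.update r.state x false) z true
     label := fun c ↦ r.label (G.retouch x y z (attach (locEdgesG false false true)) c)
     label_eq := fun u v huv ↦ by
       apply r.label_eq_of_reachable
       have h1 : Function.update (Function.update r.state x false) z true x = false := by
         rw [Function.update_of_ne hxz, Function.update_self]
       have h2 : Function.update (Function.update r.state x false) z true y = false := by
         rw [Function.update_of_ne (G.y_ne_z hc), Function.update_of_ne (G.x_ne_y ha).symm]; exact hr.2.1
       have h3 : Function.update (Function.update r.state x false) z true z = true := Function.update_self ..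
       exact G.reach_G_G hxz ha hb hc hx hy hz locCheck_G_100_001.2 (fun j hjx _ hjz ↦ by
         rw [Function.update_of_ne hjz, Function.update_of_ne hjx]) h1 h2 h3 hr.1 hr.2.1 hr.2.2 huv.reachable },
    ⟨by show Function.update (Function.update r.state x false) z true x = false
        rw [Function.update_of_ne hxz, Function.update_self],
     by show Function.update (Function.update r.state x false) z true y = false
        rw [Function.update_of_ne (G.y_ne_z hc), Function.update_of_ne (G.x_ne_y ha).symm]; exact hr.2.1,
     by show Function.update (Function.update r.state x false) z true z = true
        exact Function.update_self ..⟩⟩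

/-- The state of `aOf r`. [folklore] -/
@[simp] theorem aOf_state (r : G.EnhancedState) (hr) :
    (G.aOf hxz ha hb hc hx hy hz r hr).1.state = Function.update (Function.update r.state x false) z true := rfl

/-- **`aOf r` has the labels of `r` off the triangle.** [folklore] -/
theorem aOf_label_of_not_inT (r : G.EnhancedState) (hr) {c : G.Arc} (hc' : ¬ G.InT x y c) :
    (G.aOf hxz ha hb hc hx hy hz r hr).1.label c = r.label c := by
  show r.label (G.retouch x y z _ c) = _
  rw [G.retouch_of_not_inT _ hc']

include hxz ha hb hc hx hy hz in
/-- **The entry of `d` from a `(1, 0, 0)`-state of `G` into the loop sector with the small circle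
labelled `X`** is the Koszul sign on the transported `A`-state and vanishes elsewhere (the column
`(-) ⊗ X` of `Δ` is the identity). Khovanov (2000), §5.4; Bar-Natan (2002), §4.4. [cite: Khovanov2000, §5.4] -/
theorem incidence_zsplit_G {R : Type} [CommRing R] (hR tR : R) (r : G.EnhancedState)
    (hr : r.state x = true ∧ r.state y = false ∧ r.state z = false) (a : (G.triLoopSq hxz ha hb hc hx hy hz).XA) :
    G.incidence R hR tR r (LoopSq.embO a true) =
      if a = G.aOf hxz ha hb hc hx hy hz r hr then (edgeSign r.state z : R) else 0 := by
  have hsp := G.isSplitAt_z_G hxz ha hb hc hx hy hz hr.1 hr.2.1 hr.2.2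
  by_cases hst : a.1.state = Function.update (Function.update r.state x false) z true
  · -- a flip at `z`
    have hflip : (LoopSq.embO a true).state = Function.update r.state z true := by
      rw [LoopSq.embO_state]; show Function.update a.1.state x true = _
      rw [hst]; funext i
      by_cases hix : i = x
      · subst hix; rw [Function.update_self, Function.update_of_ne hxz, hr.1]
      · rw [Function.update_of_ne hix]
        by_cases hiz : i = z
        · subst hiz; rw [Function.update_self, Function.update_self]
        · rw [Function.update_of_ne hiz, Function.update_of_ne hix, Function.update_of_ne hiz]
    rw [G.incidence_of_flip R hR tR hr.2.2 hflip, if_neg (fun hm ↦ IsMergeAt.not_isSplitAt_holds hm hsp), if_pos hsp]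
    -- the local strands: `sideB` on the small circle, `outB` off it
    have eaI : G.arcIn (G.overPos z) = G.sideB x := G.arcIn_overPos_z hb
    have lab1 : (LoopSq.embO a true).label (G.arcIn (G.overPos z)) = true := by
      rw [eaI]; exact LoopSq.embO_label_of_inO a true (G.inT_sideB : (G.triLoopSq hxz ha hb hc hx hy hz).InO (G.sideB x))
    have lab2 : (LoopSq.embO a true).label (G.arcOut (G.overPos z)) = a.1.label (G.outB z) :=
      LoopSq.embO_label_of_not_inO a true (G.not_inT_outB (y := y) hxz : ¬ (G.triLoopSq hxz ha hb hc hx hy hz).InO (G.outB z))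
    have lr : r.label (G.arcIn (G.overPos z)) = r.label (G.outB z) := r.label_eq_of_reachable hsp.reachable
    rw [lab1, lab2, lr, splitCoeff_mid_true]
    -- the side condition on arcs off the triangle
    have hreach : ∀ c, ∃ e, ¬ G.InT x y e ∧ (G.stateGraph r.state).Reachable c e :=
      G.exists_notInT_reach_bits_G hxz ha hb hc hx hy hz (by rw [hr.1, hr.2.1, hr.2.2]; decide)
    have hiff := G.splitCond_iff_ns (fun c ↦ ¬ G.InT x y c) hsp hflip hreach
    by_cases hax : a = G.aOf hxz ha hb hc hx hy hz r hr
    · subst hax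
      rw [if_pos rfl, if_pos (hiff.2 ?_),
        if_pos (G.aOf_label_of_not_inT hxz ha hb hc hx hy hz r hr (G.not_inT_outB (y := y) hxz)), mul_one]
      intro c hc' _
      rw [LoopSq.embO_label_of_not_inO _ true (hc' : ¬ (G.triLoopSq hxz ha hb hc hx hy hz).InO c),
        G.aOf_label_of_not_inT hxz ha hb hc hx hy hz r hr hc']
    · rw [if_neg hax]
      by_cases hC : ∀ c, G.circleOf r.state c ≠ G.circleOf r.state (G.arcIn (G.overPos z)) →
          (LoopSq.embO a true).label c = r.label c
      swap
      · rw [if_neg hC]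
      rw [if_pos hC]
      have hC' := hiff.1 hC
      by_cases hℓ : a.1.label (G.outB z) = r.label (G.outB z)
      swap
      · rw [if_neg hℓ, mul_zero]
      · exfalso; apply hax
        -- labels agree off the triangle, hence everywhere
        have hreachA : ∀ c, ∃ e, ¬ G.InT x y e ∧ (G.stateGraph a.1.state).Reachable c e :=
          G.exists_notInT_reach_bits_G hxz ha hb hc hx hy hz (by rw [hst]; simp [Function.update_of_ne hxz,
            Function.update_of_ne (G.y_ne_z hc), Function.update_of_ne (G.x_ne_y ha).symm, hr.2.1])
        refine Subtype.ext (G.ext_of_notInT (fun c ↦ ¬ G.InT x y c) (hst.trans (G.aOf_state hxz ha hb hc hx hy hz r hr).symm)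
          hreachA fun c hc' ↦ ?_)
        rw [G.aOf_label_of_not_inT hxz ha hb hc hx hy hz r hr hc']
        by_cases hcc : G.circleOf r.state c = G.circleOf r.state (G.arcIn (G.overPos z))
        · -- `c` on the split circle: same label as `outB`, in `a` as in `r`
          have hco : (G.stateGraph r.state).Reachable c (G.outB z) :=
            (circleOf_eq_iff.1 hcc).trans hsp.reachable
          rw [r.label_eq_of_reachable hco, ← hℓ]
          apply a.1.label_eq_of_reachable
          rw [hst]
          have h1 : Function.update (Function.update r.state x false) z true x = false := by
            rw [Function.update_of_ne hxz, Function.update_self]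
          have h2 : Function.update (Function.update r.state x false) z true y = false := by
            rw [Function.update_of_ne (G.y_ne_z hc), Function.update_of_ne (G.x_ne_y ha).symm]; exact hr.2.1
          have key := G.reach_G_G hxz ha hb hc hx hy hz locCheck_G_100_001.1 (τ' := Function.update (Function.update r.state x false) z true)
            (fun j hjx _ hjz ↦ by rw [Function.update_of_ne hjz, Function.update_of_ne hjx]) hr.1 hr.2.1 hr.2.2 h1 h2
            (Function.update_self ..) hco
          rwa [G.retouch_of_not_inT _ hc', G.retouch_of_not_inT _ (G.not_inT_outB (y := y) hxz)] at key
        · have := hC' c hc' hcc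
          rwa [LoopSq.embO_label_of_not_inO _ true (hc' : ¬ (G.triLoopSq hxz ha hb hc hx hy hz).InO c)] at this
  · -- not a flip
    rw [if_neg (fun h ↦ hst (by rw [h]; rfl))]
    apply G.incidence_of_not_flip R hR tR
    rintro ⟨j, hj, hs⟩
    apply hst
    rw [LoopSq.embO_state] at hs
    change Function.update a.1.state x true = Function.update r.state j true at hs
    have hjz : j = z := by
      by_contra hjz
      have := congrFun hs z
      rw [Function.update_of_ne (fun h ↦ hxz h.symm), Function.update_of_ne (Ne.symm hjz), hr.2.2] at this
      exact Bool.noConfusion (((G.triLoopSq_P hxz ha hb hc hx hy hz _).1 a.2.2.2).symm.trans this)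
    subst hjz
    funext i
    by_cases hix : i = x
    · subst hix; rw [Function.update_of_ne hxz, Function.update_self]; exact a.2.1
    · have := congrFun hs i
      rw [Function.update_of_ne hix] at this
      rw [this]
      by_cases hiz : i = j
      · subst hiz; rw [Function.update_self, Function.update_self]
      · rw [Function.update_of_ne hiz, Function.update_of_ne hiz, Function.update_of_ne hix]

end ZSplit


/-! ### The transported `A`-state of the rearrangement -/

section ZSplit'

variable (G : GaussDiagram) {x y z : Fin G.n}
variable (hxz : x ≠ z) (ha : (G.overPos y : ℕ) = G.overPos x + 1) (hb : (G.overPos z : ℕ) = G.underPos x + 1)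
  (hc : (G.underPos z : ℕ) = G.underPos y + 1) (hx : G.sign x = 1) (hy : G.sign y = 1) (hz : G.sign z = 1)

variable (x y z) in
/-- The state of an enhanced state of the rearrangement, as a state of `G` (same type up to
unfolding; this fixes the implicit arguments of `Function.update`). [folklore] -/
def stG (t : (G.braidMove x y z).EnhancedState) : G.State := t.state

/-- `stG` is the state. [folklore] -/
@[simp] theorem stG_apply (t : (G.braidMove x y z).EnhancedState) (i : Fin G.n) : G.stG x y z t i = t.state i := rfl

include hxz ha hb hc hx hy hz in
/-- **The `A`-state of the rearrangement carrying the labels of a `(1, 0, 0)`-state `r₂`** (off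
the triangle). [cite: Khovanov2000, §5.4] -/
def aOf' (r₂ : (G.braidMove x y z).EnhancedState) (hr : r₂.state x = true ∧ r₂.state y = false ∧ r₂.state z = false) :
    (G.triLoopSq' hxz ha hb hc hx hy hz).XA :=
  ⟨{ state := Function.update (Function.update (G.stG x y z r₂) x false) z true
     label := fun c ↦ r₂.label (G.retouch x y z (attach (locEdgesG' false false true)) c)
     label_eq := fun u v huv ↦ by
       apply r₂.label_eq_of_reachable
       have h1 : Function.update (Function.update (G.stG x y z r₂) x false) z true x = false := by
         rw [Function.update_of_ne hxz, Function.update_self]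
       have h2 : Function.update (Function.update (G.stG x y z r₂) x false) z true y = false := by
         rw [Function.update_of_ne (G.y_ne_z hc), Function.update_of_ne (G.x_ne_y ha).symm]; exact hr.2.1
       have h3 : Function.update (Function.update (G.stG x y z r₂) x false) z true z = true := Function.update_self ..
       exact G.reach_G'_G' hxz ha hb hc hx hy hz locCheck_G'_100_001.2 (fun j hjx _ hjz ↦ by
         rw [Function.update_of_ne hjz, Function.update_of_ne hjx]; rfl) h1 h2 h3 hr.1 hr.2.1 hr.2.2 huv.reachable },
    ⟨by show Function.update (Function.update (G.stG x y z r₂) x false) z true x = false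
        rw [Function.update_of_ne hxz, Function.update_self],
     by show Function.update (Function.update (G.stG x y z r₂) x false) z true y = false
        rw [Function.update_of_ne (G.y_ne_z hc), Function.update_of_ne (G.x_ne_y ha).symm]; exact hr.2.1,
     by show Function.update (Function.update (G.stG x y z r₂) x false) z true z = true
        exact Function.update_self ..⟩⟩

/-- The state of `aOf' r₂`. [folklore] -/
@[simp] theorem aOf'_state (r₂ : (G.braidMove x y z).EnhancedState) (hr) :
    (G.aOf' hxz ha hb hc hx hy hz r₂ hr).1.state = Function.update (Function.update (G.stG x y z r₂) x false) z true := rfl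

/-- **`aOf' r₂` has the labels of `r₂` off the triangle.** [folklore] -/
theorem aOf'_label_of_not_inT (r₂ : (G.braidMove x y z).EnhancedState) (hr) {c : G.Arc} (hc' : ¬ G.InT x y c) :
    (G.aOf' hxz ha hb hc hx hy hz r₂ hr).1.label c = r₂.label c := by
  show r₂.label (G.retouch x y z _ c) = _
  rw [G.retouch_of_not_inT _ hc']

include hxz ha hb hc hx hy hz in
/-- **The entry of `d` from a `(1, 0, 0)`-state of the rearrangement into the loop sector with
the small circle labelled `X`** (the column `X ⊗ (-)`/`(-) ⊗ X` of `Δ` is the identity).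
[cite: Khovanov2000, §5.4] -/
theorem incidence_zsplit_G' {R : Type} [CommRing R] (hR tR : R) (r₂ : (G.braidMove x y z).EnhancedState)
    (hr : r₂.state x = true ∧ r₂.state y = false ∧ r₂.state z = false) (a : (G.triLoopSq' hxz ha hb hc hx hy hz).XA) :
    (G.braidMove x y z).incidence R hR tR r₂ (LoopSq.embO a true) =
      if a = G.aOf' hxz ha hb hc hx hy hz r₂ hr then (edgeSign r₂.state z : R) else 0 := by
  have hsp := G.isSplitAt_z_G' hxz ha hb hc hx hy hz hr.1 hr.2.1 hr.2.2
  by_cases hst : a.1.state = Function.update (Function.update (G.stG x y z r₂) x false) z true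
  · have hflip : (LoopSq.embO a true).state = Function.update r₂.state z true := by
      rw [LoopSq.embO_state]
      show Function.update (G.stG x y z a.1) x true = Function.update (G.stG x y z r₂) z true
      rw [show G.stG x y z a.1 = _ from hst]; funext i
      by_cases hix : i = x
      · rw [hix, Function.update_self, Function.update_of_ne hxz, stG_apply, hr.1]
      · rw [Function.update_of_ne hix]
        by_cases hiz : i = z
        · rw [hiz, Function.update_self, Function.update_self]
        · rw [Function.update_of_ne hiz, Function.update_of_ne hix, Function.update_of_ne hiz]
    rw [(G.braidMove x y z).incidence_of_flip R hR tR hr.2.2 hflip,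
      if_neg (fun hm ↦ IsMergeAt.not_isSplitAt_holds hm hsp), if_pos hsp]
    -- the local strands: `inB` off the small circle (first), `sideB` on it (second)
    have eov : (G.braidMove x y z).overPos z = G.underPos x := G.overPos_braidMove_z
    have eaI : (G.braidMove x y z).arcIn ((G.braidMove x y z).overPos z) = G.inB x := by rw [eov]; rfl
    have eaO : (G.braidMove x y z).arcOut ((G.braidMove x y z).overPos z) = G.sideB x := by rw [eov]; rfl
    have lab1 : (LoopSq.embO a true).label ((G.braidMove x y z).arcOut ((G.braidMove x y z).overPos z)) = true := by
      rw [eaO]; exact LoopSq.embO_label_of_inO a true (G.inT_sideB : (G.triLoopSq' hxz ha hb hc hx hy hz).InO (G.sideB x))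
    have lab2 : (LoopSq.embO a true).label ((G.braidMove x y z).arcIn ((G.braidMove x y z).overPos z)) = a.1.label (G.inB x) := by
      rw [eaI]; exact LoopSq.embO_label_of_not_inO a true
        (G.not_inT_inB hxz ha hb hc : ¬ (G.triLoopSq' hxz ha hb hc hx hy hz).InO (G.inB x))
    rw [lab1, lab2, eaI, splitCoeff_right_true]
    have hreach : ∀ c, ∃ e, ¬ G.InT x y e ∧ ((G.braidMove x y z).stateGraph r₂.state).Reachable c e :=
      G.exists_notInT_reach_bits_G' hxz ha hb hc hx hy hz (by rw [hr.1, hr.2.1, hr.2.2]; decide)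
    have hiff := (G.braidMove x y z).splitCond_iff_ns (fun c ↦ ¬ G.InT x y c) hsp hflip hreach
    rw [eaI] at hiff
    by_cases hax : a = G.aOf' hxz ha hb hc hx hy hz r₂ hr
    · subst hax
      rw [if_pos rfl, if_pos (hiff.2 ?_), if_pos (G.aOf'_label_of_not_inT hxz ha hb hc hx hy hz r₂ hr (G.not_inT_inB hxz ha hb hc)),
        mul_one]
      intro c hc' _
      rw [LoopSq.embO_label_of_not_inO _ true (hc' : ¬ (G.triLoopSq' hxz ha hb hc hx hy hz).InO c),
        G.aOf'_label_of_not_inT hxz ha hb hc hx hy hz r₂ hr hc']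
    · rw [if_neg hax]
      by_cases hC : ∀ c, (G.braidMove x y z).circleOf r₂.state c ≠ (G.braidMove x y z).circleOf r₂.state (G.inB x) →
          (LoopSq.embO a true).label c = r₂.label c
      swap
      · rw [if_neg hC]
      rw [if_pos hC]
      have hC' := hiff.1 hC
      by_cases hℓ : a.1.label (G.inB x) = r₂.label (G.inB x)
      swap
      · rw [if_neg hℓ, mul_zero]
      · exfalso; apply hax
        have hreachA : ∀ c, ∃ e, ¬ G.InT x y e ∧ ((G.braidMove x y z).stateGraph a.1.state).Reachable c e :=
          G.exists_notInT_reach_bits_G' hxz ha hb hc hx hy hz (σ := G.stG x y z a.1) (by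
            rw [show G.stG x y z a.1 = _ from hst]
            simp [Function.update_of_ne hxz, Function.update_of_ne (G.y_ne_z hc),
              Function.update_of_ne (G.x_ne_y ha).symm, hr.2.1])
        refine Subtype.ext ((G.braidMove x y z).ext_of_notInT (fun c ↦ ¬ G.InT x y c)
          (hst.trans (G.aOf'_state hxz ha hb hc hx hy hz r₂ hr).symm) hreachA fun c hc' ↦ ?_)
        rw [G.aOf'_label_of_not_inT hxz ha hb hc hx hy hz r₂ hr hc']
        by_cases hcc : (G.braidMove x y z).circleOf r₂.state c = (G.braidMove x y z).circleOf r₂.state (G.inB x)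
        · have hco : ((G.braidMove x y z).stateGraph r₂.state).Reachable c (G.inB x) := circleOf_eq_iff.1 hcc
          rw [r₂.label_eq_of_reachable hco, ← hℓ]
          apply a.1.label_eq_of_reachable
          rw [hst]
          have h1 : Function.update (Function.update (G.stG x y z r₂) x false) z true x = false := by
            rw [Function.update_of_ne hxz, Function.update_self]
          have h2 : Function.update (Function.update (G.stG x y z r₂) x false) z true y = false := by
            rw [Function.update_of_ne (G.y_ne_z hc), Function.update_of_ne (G.x_ne_y ha).symm]; exact hr.2.1
          have key := G.reach_G'_G' hxz ha hb hc hx hy hz locCheck_G'_100_001.1 (τ := G.stG x y z r₂)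
            (τ' := Function.update (Function.update (G.stG x y z r₂) x false) z true)
            (fun j hjx _ hjz ↦ by rw [Function.update_of_ne hjz, Function.update_of_ne hjx]) hr.1 hr.2.1 hr.2.2 h1 h2
            (Function.update_self ..) hco
          rwa [G.retouch_of_not_inT _ hc', G.retouch_of_not_inT _ (G.not_inT_inB hxz ha hb hc)] at key
        · have := hC' c hc' hcc
          rwa [LoopSq.embO_label_of_not_inO _ true (hc' : ¬ (G.triLoopSq' hxz ha hb hc hx hy hz).InO c)] at this
  · rw [if_neg (fun h ↦ hst (by rw [h]; rfl))]
    apply (G.braidMove x y z).incidence_of_not_flip R hR tR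
    rintro ⟨j, hj, hs⟩
    apply hst
    rw [LoopSq.embO_state] at hs
    change Function.update (G.stG x y z a.1) x true = Function.update (G.stG x y z r₂) j true at hs
    have hjz : j = z := by
      by_contra hjz
      have := congrFun hs z
      rw [Function.update_of_ne (fun h ↦ hxz h.symm), Function.update_of_ne (show (z : Fin G.n) ≠ j from fun h ↦ hjz h.symm),
        stG_apply, stG_apply, hr.2.2] at this
      exact Bool.noConfusion (((G.triLoopSq'_P hxz ha hb hc hx hy hz _).1 a.2.2.2).symm.trans this)
    rw [hjz] at hs
    show (G.stG x y z a.1) = _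
    funext i
    by_cases hix : i = x
    · rw [hix, Function.update_of_ne hxz, Function.update_self]; exact a.2.1
    · have := congrFun hs i
      rw [Function.update_of_ne hix] at this
      rw [this]
      by_cases hiz : i = z
      · rw [hiz, Function.update_self, Function.update_self]
      · rw [Function.update_of_ne hiz, Function.update_of_ne hiz, Function.update_of_ne hix]

end ZSplit'


/-! ## Collapse of the correction sums and transport of the remaining edge -/

section Collapse

variable (G : GaussDiagram) {x y z : Fin G.n}
variable (hxz : x ≠ z) (ha : (G.overPos y : ℕ) = G.overPos x + 1) (hb : (G.overPos z : ℕ) = G.underPos x + 1)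
  (hc : (G.underPos z : ℕ) = G.underPos y + 1) (hx : G.sign x = 1) (hy : G.sign y = 1) (hz : G.sign z = 1)

include hxz ha hb hc hx hy hz in
/-- **The correction sum of `G` has a single term.** [cite: Khovanov2000, §5.4] -/
theorem sum_zsplit_G {R : Type} [CommRing R] (hR tR : R) (r : G.EnhancedState)
    (hr : r.state x = true ∧ r.state y = false ∧ r.state z = false) (t : G.EnhancedState) :
    ∑ a : (G.triLoopSq hxz ha hb hc hx hy hz).XA, G.incidence R hR tR r (LoopSq.embO a true) *
        (edgeSign a.1.state x : R) * G.incidence R hR tR a.1 t =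
      (edgeSign r.state z : R) * (edgeSign (G.aOf hxz ha hb hc hx hy hz r hr).1.state x : R) *
        G.incidence R hR tR (G.aOf hxz ha hb hc hx hy hz r hr).1 t := by
  simp_rw [G.incidence_zsplit_G hxz ha hb hc hx hy hz hR tR r hr, ite_mul, zero_mul]
  rw [Finset.sum_ite_eq' Finset.univ (G.aOf hxz ha hb hc hx hy hz r hr), if_pos (Finset.mem_univ _)]

include hxz ha hb hc hx hy hz in
/-- **The correction sum of the rearrangement has a single term.** [cite: Khovanov2000, §5.4] -/
theorem sum_zsplit_G' {R : Type} [CommRing R] (hR tR : R) (r₂ : (G.braidMove x y z).EnhancedState)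
    (hr : r₂.state x = true ∧ r₂.state y = false ∧ r₂.state z = false) (t₂ : (G.braidMove x y z).EnhancedState) :
    ∑ a : (G.triLoopSq' hxz ha hb hc hx hy hz).XA, (G.braidMove x y z).incidence R hR tR r₂ (LoopSq.embO a true) *
        (edgeSign a.1.state x : R) * (G.braidMove x y z).incidence R hR tR a.1 t₂ =
      (edgeSign r₂.state z : R) * (edgeSign (G.aOf' hxz ha hb hc hx hy hz r₂ hr).1.state x : R) *
        (G.braidMove x y z).incidence R hR tR (G.aOf' hxz ha hb hc hx hy hz r₂ hr).1 t₂ := by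
  simp_rw [G.incidence_zsplit_G' hxz ha hb hc hx hy hz hR tR r₂ hr, ite_mul, zero_mul]
  rw [Finset.sum_ite_eq' Finset.univ (G.aOf' hxz ha hb hc hx hy hz r₂ hr), if_pos (Finset.mem_univ _)]

include hxz ha hb hc hx hy hz in
/-- **Transport of the `y`-edge out of the transported `A`-state of `G` against the `z`-edge of
the rearrangement out of the corresponding rest state** (cross block `(1,0,0) → D₁`).
[cite: Khovanov2000, §5.4] -/
theorem transport_cross_b {R : Type} [CommRing R] (hR tR : R) (r r' : G.EnhancedState)
    (hr : r.state x = true ∧ r.state y = false ∧ r.state z = false)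
    (hrs : ¬ (r.state z = true ∧ (r.state x = false → r.state y = false)))
    (hr's : ¬ (r'.state z = true ∧ (r'.state x = false → r'.state y = false)))
    (hρ : r'.state = Function.update (G.aOf hxz ha hb hc hx hy hz r hr).1.state y true) :
    (G.braidMove x y z).incidence R hR tR (G.toG' hxz ha hb hc hx hy hz r hrs) (G.toG' hxz ha hb hc hx hy hz r' hr's) *
        (edgeSign (G.aOf hxz ha hb hc hx hy hz r hr).1.state y : R) =
      (edgeSign (G.toG' hxz ha hb hc hx hy hz r hrs).state z : R) *
        G.incidence R hR tR (G.aOf hxz ha hb hc hx hy hz r hr).1 r' := by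
  -- the four states and their smoothings of `x, y, z`
  have a1 : (G.aOf hxz ha hb hc hx hy hz r hr).1.state x = false := (G.aOf hxz ha hb hc hx hy hz r hr).2.1
  have a2 : (G.aOf hxz ha hb hc hx hy hz r hr).1.state y = false := (G.aOf hxz ha hb hc hx hy hz r hr).2.2.1
  have a3 : (G.aOf hxz ha hb hc hx hy hz r hr).1.state z = true :=
    (G.triLoopSq_P hxz ha hb hc hx hy hz _).1 (G.aOf hxz ha hb hc hx hy hz r hr).2.2.2
  have t1 : r'.state x = false := by rw [hρ, Function.update_of_ne (G.x_ne_y ha), a1]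
  have t2 : r'.state y = true := by rw [hρ, Function.update_self]
  have t3 : r'.state z = true := by rw [hρ, Function.update_of_ne (G.y_ne_z hc).symm, a3]
  have s1 : (G.toG' hxz ha hb hc hx hy hz r hrs).state x = false := by rw [toG'_state, G.swapSt_x hr.2.2, hr.2.1]
  have s2 : (G.toG' hxz ha hb hc hx hy hz r hrs).state y = true := by rw [toG'_state, G.swapSt_y hr.2.2, hr.1]
  have s3 : (G.toG' hxz ha hb hc hx hy hz r hrs).state z = false := by rw [toG'_state, G.swapSt_z hxz hc, hr.2.2]
  have u0 : (G.toG' hxz ha hb hc hx hy hz r' hr's).state = r'.state := by rw [toG'_state, G.swapSt_of_z t3]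
  have hagree : ∀ j, j ≠ x → j ≠ y → j ≠ z → (G.aOf hxz ha hb hc hx hy hz r hr).1.state j = r.state j :=
    fun j hjx _ hjz ↦ by rw [aOf_state, Function.update_of_ne hjz, Function.update_of_ne hjx]
  -- the flip on the other side
  have ht₂ : (G.toG' hxz ha hb hc hx hy hz r' hr's).state =
      Function.update (G.toG' hxz ha hb hc hx hy hz r hrs).state z true := by
    show G.swapSt x y z r'.state = Function.update (G.swapSt x y z r.state) z true
    rw [G.swapSt_of_z t3, G.swapSt_of_not_z (by rw [hr.2.2]; exact Bool.false_ne_true), hρ, aOf_state]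
    funext i
    by_cases hix : i = x
    · rw [hix, Function.update_of_ne (G.x_ne_y ha), Function.update_of_ne hxz, Function.update_self,
        Function.update_of_ne hxz, comp_apply, Equiv.swap_apply_left, hr.2.1]
    by_cases hiy : i = y
    · rw [hiy, Function.update_self, Function.update_of_ne (G.y_ne_z hc), comp_apply, Equiv.swap_apply_right, hr.1]
    by_cases hiz : i = z
    · rw [hiz, Function.update_of_ne (G.y_ne_z hc).symm, Function.update_self, Function.update_self]
    · rw [Function.update_of_ne hiy, Function.update_of_ne hiz, Function.update_of_ne hix, Function.update_of_ne hiz,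
        comp_apply, Equiv.swap_apply_of_ne_of_ne hix hiy]
  -- circles off the triangle
  have hRs : ∀ u v, ¬ G.InT x y u → ¬ G.InT x y v →
      ((G.stateGraph (G.aOf hxz ha hb hc hx hy hz r hr).1.state).Reachable u v ↔
        ((G.braidMove x y z).stateGraph (G.toG' hxz ha hb hc hx hy hz r hrs).state).Reachable u v) := by
    intro u v hu hv
    rw [toG'_state, ← G.reach_iff_swapSt hxz ha hb hc hx hy hz hrs hu hv]
    constructor
    · intro h
      have key := G.reach_G_G hxz ha hb hc hx hy hz locCheck_G_100_001.2 (hagree) a1 a2 a3 hr.1 hr.2.1 hr.2.2 h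
      rwa [G.retouch_of_not_inT _ hu, G.retouch_of_not_inT _ hv] at key
    · intro h
      have key := G.reach_G_G hxz ha hb hc hx hy hz locCheck_G_100_001.1 (fun j h1 h2 h3 ↦ (hagree j h1 h2 h3).symm)
        hr.1 hr.2.1 hr.2.2 a1 a2 a3 h
      rwa [G.retouch_of_not_inT _ hu, G.retouch_of_not_inT _ hv] at key
  have hRt : ∀ u v, ¬ G.InT x y u → ¬ G.InT x y v →
      ((G.stateGraph r'.state).Reachable u v ↔
        ((G.braidMove x y z).stateGraph (G.toG' hxz ha hb hc hx hy hz r' hr's).state).Reachable u v) :=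
    fun u v hu hv ↦ G.reach_iff_swapSt hxz ha hb hc hx hy hz hr's hu hv
  have eovz : (G.braidMove x y z).overPos z = G.underPos x := G.overPos_braidMove_z
  have eaI : G.arcIn (G.overPos y) = G.sideA x := G.arcIn_overPos_y ha
  refine G.incidence_transport hR tR a2 hρ s3 ht₂ hRs hRt
    (fun c hc' ↦ by rw [G.toG'_label_of_not_inT hxz ha hb hc hx hy hz r hrs hc', G.aOf_label_of_not_inT hxz ha hb hc hx hy hz r hr hc'])
    (fun c hc' ↦ G.toG'_label_of_not_inT hxz ha hb hc hx hy hz r' hr's hc')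
    (G.exists_notInT_reach_bits_G hxz ha hb hc hx hy hz (by rw [a1, a2, a3]; decide))
    (G.exists_notInT_reach_G hxz ha hb hc hx hy hz hr's)
    (G.exists_notInT_reach_G' hxz ha hb hc hx hy hz (G.rest_toG' hxz ha hb hc hx hy hz r hrs))
    (G.exists_notInT_reach_G' hxz ha hb hc hx hy hz (G.rest_toG' hxz ha hb hc hx hy hz r' hr's))
    (a₀ := G.inB x) (b₀ := G.outA y) (G.not_inT_inB hxz ha hb hc) (G.not_inT_outA ha) ?_ ?_ (.refl _) (.refl _)
    (by rw [eovz]; exact .refl _) (by rw [eovz, u0]; exact .refl _) ?_ ?_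
  · rw [eaI]
    exact G.reach_G_of_locReachB ha hb hc hx hy hz _ (a := .sA) (b := .inB) (by rw [a1, a2, a3]; decide)
  · rw [eaI]
    exact G.reach_G_of_locReachB ha hb hc hx hy hz _ (a := .sA) (b := .inB) (by rw [t1, t2, t3]; decide)
  · rw [eovz]
    exact G.reach_G'_of_locReachB hxz ha hb hc hx hy hz _ (a := .sB) (b := .outA) (by rw [s1, s2, s3]; decide)
  · rw [eovz, u0]
    exact G.reach_G'_of_locReachB hxz ha hb hc hx hy hz _ (a := .sB) (b := .outA) (by rw [t1, t2, t3]; decide)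

end Collapse


section CollapseA

variable (G : GaussDiagram) {x y z : Fin G.n}
variable (hxz : x ≠ z) (ha : (G.overPos y : ℕ) = G.overPos x + 1) (hb : (G.overPos z : ℕ) = G.underPos x + 1)
  (hc : (G.underPos z : ℕ) = G.underPos y + 1) (hx : G.sign x = 1) (hy : G.sign y = 1) (hz : G.sign z = 1)

/-- The smoothings of `toG' r` for a `(0, 1, 0)`-state `r`. [folklore] -/
theorem bits_toG'_010 (r : G.EnhancedState) (hr : r.state x = false ∧ r.state y = true ∧ r.state z = false) (hrs) :
    (G.toG' hxz ha hb hc hx hy hz r hrs).state x = true ∧ (G.toG' hxz ha hb hc hx hy hz r hrs).state y = false ∧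
      (G.toG' hxz ha hb hc hx hy hz r hrs).state z = false := by
  refine ⟨?_, ?_, ?_⟩
  · rw [toG'_state, G.swapSt_x hr.2.2, hr.2.1]
  · rw [toG'_state, G.swapSt_y hr.2.2, hr.1]
  · rw [toG'_state, G.swapSt_z hxz hc, hr.2.2]

include hxz ha hb hc hx hy hz in
/-- **Transport of the `z`-edge out of a `(0, 1, 0)` rest state of `G` against the `y`-edge of
the rearrangement out of the transported `A`-state** (cross block `(0,1,0) → D₁`).
[cite: Khovanov2000, §5.4] -/
theorem transport_cross_a {R : Type} [CommRing R] (hR tR : R) (r r' : G.EnhancedState)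
    (hr : r.state x = false ∧ r.state y = true ∧ r.state z = false)
    (hrs : ¬ (r.state z = true ∧ (r.state x = false → r.state y = false)))
    (hr's : ¬ (r'.state z = true ∧ (r'.state x = false → r'.state y = false)))
    (hρ : r'.state = Function.update r.state z true) :
    (G.braidMove x y z).incidence R hR tR
        (G.aOf' hxz ha hb hc hx hy hz (G.toG' hxz ha hb hc hx hy hz r hrs) (G.bits_toG'_010 hxz ha hb hc hx hy hz r hr hrs)).1
        (G.toG' hxz ha hb hc hx hy hz r' hr's) * (edgeSign r.state z : R) =
      (edgeSign (G.aOf' hxz ha hb hc hx hy hz (G.toG' hxz ha hb hc hx hy hz r hrs)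
          (G.bits_toG'_010 hxz ha hb hc hx hy hz r hr hrs)).1.state y : R) * G.incidence R hR tR r r' := by
  have h₂ := G.bits_toG'_010 hxz ha hb hc hx hy hz r hr hrs
  set a₂ := G.aOf' hxz ha hb hc hx hy hz (G.toG' hxz ha hb hc hx hy hz r hrs) h₂ with ha₂
  have a1 : a₂.1.state x = false := a₂.2.1
  have a2' : a₂.1.state y = false := a₂.2.2.1
  have a3 : a₂.1.state z = true := (G.triLoopSq'_P hxz ha hb hc hx hy hz _).1 a₂.2.2.2
  have t1 : r'.state x = false := by rw [hρ, Function.update_of_ne hxz, hr.1]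
  have t2 : r'.state y = true := by rw [hρ, Function.update_of_ne (G.y_ne_z hc), hr.2.1]
  have t3 : r'.state z = true := by rw [hρ, Function.update_self]
  have u0 : (G.toG' hxz ha hb hc hx hy hz r' hr's).state = r'.state := by rw [toG'_state, G.swapSt_of_z t3]
  have hagree : ∀ j, j ≠ x → j ≠ y → j ≠ z → r.state j = a₂.1.state j := fun j hjx hjy hjz ↦ by
    rw [ha₂, aOf'_state, Function.update_of_ne hjz, Function.update_of_ne hjx, stG_apply, toG'_state,
      G.swapSt_of_ne _ hjx hjy]
  -- the flip on the other side
  have ht₂ : (G.toG' hxz ha hb hc hx hy hz r' hr's).state = Function.update a₂.1.state y true := by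
    show G.swapSt x y z r'.state =
      Function.update (Function.update (Function.update (G.stG x y z (G.toG' hxz ha hb hc hx hy hz r hrs)) x false) z true) y true
    rw [G.swapSt_of_z t3, hρ]
    funext i
    by_cases hiy : i = y
    · rw [hiy, Function.update_self, Function.update_of_ne (G.y_ne_z hc), hr.2.1]
    rw [Function.update_of_ne hiy]
    by_cases hiz : i = z
    · rw [hiz, Function.update_self, Function.update_self]
    rw [Function.update_of_ne hiz, Function.update_of_ne hiz]
    by_cases hix : i = x
    · rw [hix, Function.update_self, hr.1]
    · rw [Function.update_of_ne hix, stG_apply, toG'_state, G.swapSt_of_ne _ hix hiy]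
  have hRs : ∀ u v, ¬ G.InT x y u → ¬ G.InT x y v →
      ((G.stateGraph r.state).Reachable u v ↔ ((G.braidMove x y z).stateGraph a₂.1.state).Reachable u v) := by
    intro u v hu hv
    constructor
    · intro h
      have key := G.reach_G_G' hxz ha hb hc hx hy hz locCheck_010_001.1 hagree hr.1 hr.2.1 hr.2.2 a1 a2' a3 h
      rwa [G.retouch_of_not_inT _ hu, G.retouch_of_not_inT _ hv] at key
    · intro h
      have key := G.reach_G'_G hxz ha hb hc hx hy hz locCheck_010_001.2 (fun j h1 h2 h3 ↦ (hagree j h1 h2 h3).symm)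
        a1 a2' a3 hr.1 hr.2.1 hr.2.2 h
      rwa [G.retouch_of_not_inT _ hu, G.retouch_of_not_inT _ hv] at key
  have hRt : ∀ u v, ¬ G.InT x y u → ¬ G.InT x y v →
      ((G.stateGraph r'.state).Reachable u v ↔
        ((G.braidMove x y z).stateGraph (G.toG' hxz ha hb hc hx hy hz r' hr's).state).Reachable u v) :=
    fun u v hu hv ↦ G.reach_iff_swapSt hxz ha hb hc hx hy hz hr's hu hv
  have eovy : (G.braidMove x y z).overPos y = G.overPos x := G.overPos_braidMove_y (G.y_ne_z hc)
  have eaI : G.arcIn (G.overPos z) = G.sideB x := G.arcIn_overPos_z hb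
  refine G.incidence_transport hR tR hr.2.2 hρ a2' ht₂ hRs hRt
    (fun c hc' ↦ by rw [ha₂, G.aOf'_label_of_not_inT hxz ha hb hc hx hy hz _ h₂ hc', G.toG'_label_of_not_inT hxz ha hb hc hx hy hz r hrs hc'])
    (fun c hc' ↦ G.toG'_label_of_not_inT hxz ha hb hc hx hy hz r' hr's hc')
    (G.exists_notInT_reach_G hxz ha hb hc hx hy hz hrs)
    (G.exists_notInT_reach_G hxz ha hb hc hx hy hz hr's)
    (G.exists_notInT_reach_bits_G' hxz ha hb hc hx hy hz (by rw [a1, a2', a3]; decide))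
    (G.exists_notInT_reach_G' hxz ha hb hc hx hy hz (G.rest_toG' hxz ha hb hc hx hy hz r' hr's))
    (a₀ := G.inA x) (b₀ := G.outB z) (G.not_inT_inA hxz ha hb hc) (G.not_inT_outB (y := y) hxz) ?_ ?_ (.refl _) (.refl _)
    (by rw [eovy]; exact .refl _) (by rw [eovy]; exact .refl _) ?_ ?_
  · rw [eaI]
    exact G.reach_G_of_locReachB ha hb hc hx hy hz _ (a := .sB) (b := .inA) (by rw [hr.1, hr.2.1, hr.2.2]; decide)
  · rw [eaI]
    exact G.reach_G_of_locReachB ha hb hc hx hy hz _ (a := .sB) (b := .inA) (by rw [t1, t2, t3]; decide)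
  · rw [eovy]
    exact G.reach_G'_of_locReachB hxz ha hb hc hx hy hz _ (a := .sA) (b := .outB) (by rw [a1, a2', a3]; decide)
  · rw [eovy, u0]
    exact G.reach_G'_of_locReachB hxz ha hb hc hx hy hz _ (a := .sA) (b := .outB) (by rw [t1, t2, t3]; decide)

end CollapseA


/-! ## The cross identities at the level of the reduced differentials -/

section Final

variable (G : GaussDiagram) {x y z : Fin G.n}
variable (hxz : x ≠ z) (ha : (G.overPos y : ℕ) = G.overPos x + 1) (hb : (G.overPos z : ℕ) = G.underPos x + 1)
  (hc : (G.underPos z : ℕ) = G.underPos y + 1) (hx : G.sign x = 1) (hy : G.sign y = 1) (hz : G.sign z = 1)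

/-- **An incidence number vanishes when two chords would have to flip.** [folklore] -/
theorem incidence_eq_zero_of_two {K : GaussDiagram} {R : Type} [CommRing R] (hR tR : R) {s t : K.EnhancedState}
    {i j : Fin K.n} (hij : i ≠ j) (hi : s.state i = false) (hi' : t.state i = true) (hj : s.state j = false)
    (hj' : t.state j = true) : K.incidence R hR tR s t = 0 := by
  by_contra hne
  obtain ⟨k, -, hs⟩ := exists_of_incidence_ne_zero hne
  have h1 := congrFun hs i; have h2 := congrFun hs j
  rw [hi'] at h1; rw [hj'] at h2
  by_cases hik : i = k
  · subst hik
    rw [Function.update_of_ne (Ne.symm hij), hj] at h2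
    exact Bool.noConfusion h2
  · rw [Function.update_of_ne hik, hi] at h1
    exact Bool.noConfusion h1

/-- The Koszul potential of `(x y)` is invariant under `(x y)`. [folklore] -/
theorem koszulXY_comp_swap (σ : G.State) : koszulXY x y (σ ∘ Equiv.swap x y) = koszulXY x y σ := by
  unfold koszulXY btwSgn
  simp only [comp_apply, Equiv.swap_apply_left, Equiv.swap_apply_right]
  have e : ∀ k, ((x < k ∧ k < y) ∨ (y < k ∧ k < x)) → σ (Equiv.swap x y k) = σ k := fun k hk ↦ by
    rw [Equiv.swap_apply_of_ne_of_ne]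
    · rintro rfl; rcases hk with ⟨h, -⟩ | ⟨-, h⟩ <;> exact lt_irrefl _ h
    · rintro rfl; rcases hk with ⟨-, h⟩ | ⟨h, -⟩ <;> exact lt_irrefl _ h
  have e2 : (∏ k, if (x < k ∧ k < y) ∨ (y < k ∧ k < x) then bsgn (σ (Equiv.swap x y k)) else 1) =
      ∏ k, if (x < k ∧ k < y) ∨ (y < k ∧ k < x) then bsgn (σ k) else 1 :=
    Finset.prod_congr rfl fun k _ ↦ by by_cases hk : (x < k ∧ k < y) ∨ (y < k ∧ k < x) <;> simp [hk, e]
  rw [e2]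
  cases σ x <;> cases σ y <;> simp

/-- A rest state in the layer `z = 1` has smoothings `(0, 1, 1)`. [folklore] -/
theorem bits_of_rest_z {σ : G.State} (h : ¬ (σ z = true ∧ (σ x = false → σ y = false))) (hzb : σ z = true) :
    σ x = false ∧ σ y = true := by
  cases hxb : σ x <;> cases hyb : σ y
  · exact (h ⟨hzb, fun _ ↦ hyb⟩).elim
  · exact ⟨rfl, rfl⟩
  · exact (h ⟨hzb, fun h' ↦ by rw [hxb] at h'; exact Bool.noConfusion h'⟩).elim
  · exact (h ⟨hzb, fun h' ↦ by rw [hxb] at h'; exact Bool.noConfusion h'⟩).elim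

variable {R : Type} [CommRing R] (hR tR : R)

/-- The reduced differential of the triangle loop square of `G`, unfolded. [folklore] -/
theorem loopM_tri (r r' : (G.triLoopSq hxz ha hb hc hx hy hz).XR) :
    (G.triLoopSq hxz ha hb hc hx hy hz).loopM hR tR r r' = G.incidence R hR tR r.1 r'.1 -
      ∑ a : (G.triLoopSq hxz ha hb hc hx hy hz).XA, G.incidence R hR tR r.1 (LoopSq.embO a true) *
        (edgeSign a.1.state x : R) * G.incidence R hR tR a.1 r'.1 := rfl

/-- The reduced differential of the triangle loop square of the rearrangement, unfolded. [folklore] -/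
theorem loopM_tri' (r r' : (G.triLoopSq' hxz ha hb hc hx hy hz).XR) :
    (G.triLoopSq' hxz ha hb hc hx hy hz).loopM hR tR r r' = (G.braidMove x y z).incidence R hR tR r.1 r'.1 -
      ∑ a : (G.triLoopSq' hxz ha hb hc hx hy hz).XA, (G.braidMove x y z).incidence R hR tR r.1 (LoopSq.embO a true) *
        (edgeSign a.1.state x : R) * (G.braidMove x y z).incidence R hR tR a.1 r'.1 := rfl

/-- The correction sum of `G` vanishes from a state with `y = 1`. [folklore] -/
theorem sum_eq_zero_of_y_G (r t : G.EnhancedState) (hry : r.state y = true) :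
    ∑ a : (G.triLoopSq hxz ha hb hc hx hy hz).XA, G.incidence R hR tR r (LoopSq.embO a true) *
        (edgeSign a.1.state x : R) * G.incidence R hR tR a.1 t = 0 := by
  refine Finset.sum_eq_zero fun a _ ↦ ?_
  rw [incidence_eq_zero_of_state_true_false hR tR y hry, zero_mul, zero_mul]
  rw [LoopSq.embO_state]; show Function.update a.1.state x true y = false
  rw [Function.update_of_ne (G.x_ne_y ha).symm]; exact a.2.2.1

/-- The correction sum of the rearrangement vanishes from a state with `y = 1`. [folklore] -/
theorem sum_eq_zero_of_y_G' (r₂ t₂ : (G.braidMove x y z).EnhancedState) (hry : r₂.state y = true) :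
    ∑ a : (G.triLoopSq' hxz ha hb hc hx hy hz).XA, (G.braidMove x y z).incidence R hR tR r₂ (LoopSq.embO a true) *
        (edgeSign a.1.state x : R) * (G.braidMove x y z).incidence R hR tR a.1 t₂ = 0 := by
  refine Finset.sum_eq_zero fun a _ ↦ ?_
  rw [incidence_eq_zero_of_state_true_false (H := G.braidMove x y z) hR tR y hry, zero_mul, zero_mul]
  rw [LoopSq.embO_state]; show Function.update (G.stG x y z a.1) x true y = false
  rw [Function.update_of_ne (G.x_ne_y ha).symm]; exact a.2.2.1

/-- The correction sum of `G` vanishes into a state with `z = 0`. [folklore] -/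
theorem sum_eq_zero_of_z_G (r t : G.EnhancedState) (htz : t.state z = false) :
    ∑ a : (G.triLoopSq hxz ha hb hc hx hy hz).XA, G.incidence R hR tR r (LoopSq.embO a true) *
        (edgeSign a.1.state x : R) * G.incidence R hR tR a.1 t = 0 := by
  refine Finset.sum_eq_zero fun a _ ↦ ?_
  rw [incidence_eq_zero_of_state_true_false hR tR z ((G.triLoopSq_P hxz ha hb hc hx hy hz _).1 a.2.2.2) htz, mul_zero]

/-- The correction sum of the rearrangement vanishes into a state with `z = 0`. [folklore] -/
theorem sum_eq_zero_of_z_G' (r₂ t₂ : (G.braidMove x y z).EnhancedState) (htz : t₂.state z = false) :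
    ∑ a : (G.triLoopSq' hxz ha hb hc hx hy hz).XA, (G.braidMove x y z).incidence R hR tR r₂ (LoopSq.embO a true) *
        (edgeSign a.1.state x : R) * (G.braidMove x y z).incidence R hR tR a.1 t₂ = 0 := by
  refine Finset.sum_eq_zero fun a _ ↦ ?_
  rw [incidence_eq_zero_of_state_true_false (H := G.braidMove x y z) hR tR z
    ((G.triLoopSq'_P hxz ha hb hc hx hy hz _).1 a.2.2.2) htz, mul_zero]

/-- The correction sum of `G` vanishes from a `(0, 0, 0)`-state. [folklore] -/
theorem sum_eq_zero_of_000_G (r t : G.EnhancedState) (hrx : r.state x = false) (hrz : r.state z = false) :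
    ∑ a : (G.triLoopSq hxz ha hb hc hx hy hz).XA, G.incidence R hR tR r (LoopSq.embO a true) *
        (edgeSign a.1.state x : R) * G.incidence R hR tR a.1 t = 0 := by
  refine Finset.sum_eq_zero fun a _ ↦ ?_
  have e1 : (LoopSq.embO a true).state x = true := by rw [LoopSq.embO_state]; exact Function.update_self ..
  have e2 : (LoopSq.embO a true).state z = true := by
    rw [LoopSq.embO_state]; show Function.update a.1.state x true z = true
    rw [Function.update_of_ne (fun h ↦ hxz h.symm)]; exact (G.triLoopSq_P hxz ha hb hc hx hy hz _).1 a.2.2.2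
  rw [incidence_eq_zero_of_two hR tR hxz hrx e1 hrz e2, zero_mul, zero_mul]

/-- The correction sum of the rearrangement vanishes from a `(0, 0, 0)`-state. [folklore] -/
theorem sum_eq_zero_of_000_G' (r₂ t₂ : (G.braidMove x y z).EnhancedState) (hrx : r₂.state x = false) (hrz : r₂.state z = false) :
    ∑ a : (G.triLoopSq' hxz ha hb hc hx hy hz).XA, (G.braidMove x y z).incidence R hR tR r₂ (LoopSq.embO a true) *
        (edgeSign a.1.state x : R) * (G.braidMove x y z).incidence R hR tR a.1 t₂ = 0 := by
  refine Finset.sum_eq_zero fun a _ ↦ ?_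
  have e1 : (LoopSq.embO a true).state x = true := by rw [LoopSq.embO_state]; exact Function.update_self ..
  have e2 : (LoopSq.embO a true).state z = true := by
    rw [LoopSq.embO_state]; show Function.update (G.stG x y z a.1) x true z = true
    rw [Function.update_of_ne (fun h ↦ hxz h.symm)]; exact (G.triLoopSq'_P hxz ha hb hc hx hy hz _).1 a.2.2.2
  rw [incidence_eq_zero_of_two (K := G.braidMove x y z) hR tR hxz hrx e1 hrz e2, zero_mul, zero_mul]

end Final


section CrossB

variable (G : GaussDiagram) {x y z : Fin G.n}
variable (hxz : x ≠ z) (ha : (G.overPos y : ℕ) = G.overPos x + 1) (hb : (G.overPos z : ℕ) = G.underPos x + 1)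
  (hc : (G.underPos z : ℕ) = G.underPos y + 1) (hx : G.sign x = 1) (hy : G.sign y = 1) (hz : G.sign z = 1)
variable {R : Type} [CommRing R] (hR tR : R)

/-- `(σ ∘ (x y)) ∘ (x y) = σ`. [folklore] -/
theorem comp_swap_comp_swap (σ : G.State) : (σ ∘ Equiv.swap x y) ∘ Equiv.swap x y = σ := by
  funext i; simp

include hxz ha hb hc hx hy hz in
/-- **The cross block from a `(1, 0, 0)` rest state corresponds under the move**: on `G` it is
the correction term through the loop sector, on the rearrangement the plain `z`-saddle, and they
agree up to the gauge ((**) of the notes; Bar-Natan's `d ∘ F = d`). [cite: Khovanov2000, §5.4] -/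
theorem loopM_cross_b (r r' : (G.triLoopSq hxz ha hb hc hx hy hz).XR)
    (hr : r.1.state x = true ∧ r.1.state y = false ∧ r.1.state z = false) (hr'z : r'.1.state z = true) :
    (G.triLoopSq' hxz ha hb hc hx hy hz).loopM hR tR (G.restEquiv hxz ha hb hc hx hy hz r) (G.restEquiv hxz ha hb hc hx hy hz r') =
      (G.gauge x y z r.1.state : R) * (G.gauge x y z r'.1.state : R) * (G.triLoopSq hxz ha hb hc hx hy hz).loopM hR tR r r' := by
  obtain ⟨t1, t2⟩ := G.bits_of_rest_z r'.2 hr'z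
  have s2 : (G.toG' hxz ha hb hc hx hy hz r.1 r.2).state y = true := by rw [toG'_state, G.swapSt_y hr.2.2, hr.1]
  have s3 : (G.toG' hxz ha hb hc hx hy hz r.1 r.2).state z = false := by rw [toG'_state, G.swapSt_z hxz hc, hr.2.2]
  have u0 : (G.toG' hxz ha hb hc hx hy hz r'.1 r'.2).state = r'.1.state := by rw [toG'_state, G.swapSt_of_z hr'z]
  rw [loopM_tri, loopM_tri']
  simp only [restEquiv_apply]
  rw [G.sum_eq_zero_of_y_G' hxz ha hb hc hx hy hz hR tR _ _ s2, sub_zero,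
    incidence_eq_zero_of_state_true_false hR tR x hr.1 t1, zero_sub,
    G.sum_zsplit_G hxz ha hb hc hx hy hz hR tR r.1 hr r'.1]
  have hg : (G.gauge x y z r.1.state : R) = koszulXY x y r.1.state := by
    unfold gauge; rw [hr.2.2]; simp
  have hg' : (G.gauge x y z r'.1.state : R) = -1 := by unfold gauge; rw [hr'z]; simp
  rw [hg, hg']
  by_cases hρ : r'.1.state = Function.update (G.aOf hxz ha hb hc hx hy hz r.1 hr).1.state y true
  · -- the transported edge and the sign identity
    have key := G.transport_cross_b hxz ha hb hc hx hy hz hR tR r.1 r'.1 hr r.2 r'.2 hρ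
    have cs := congrArg (Int.cast : ℤ → R)
      (cross_sign (G.x_ne_y ha) hxz (G.y_ne_z hc) r.1.state hr.1 hr.2.1 hr.2.2)
    push_cast at cs
    have e1 : (G.toG' hxz ha hb hc hx hy hz r.1 r.2).state = r.1.state ∘ Equiv.swap x y := by
      rw [toG'_state, G.swapSt_of_not_z (by rw [hr.2.2]; exact Bool.false_ne_true)]
    have q1 := Transfer.edgeSign_mul_self (R := R) (Function.update (Function.update r.1.state x false) z true) y
    have q2 := Transfer.edgeSign_mul_self (R := R) (Function.update (Function.update r.1.state x false) z true) x
    have q3 := Transfer.edgeSign_mul_self (R := R) r.1.state z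
    simp only [aOf_state] at key ⊢
    -- `I' = E(r∘π, z) E(α, y) I` and `E(α,x) E(r,z) E(r∘π,z) E(α,y) = κ`
    set I' := (G.braidMove x y z).incidence R hR tR (G.toG' hxz ha hb hc hx hy hz r.1 r.2) (G.toG' hxz ha hb hc hx hy hz r'.1 r'.2)
    set I := G.incidence R hR tR (G.aOf hxz ha hb hc hx hy hz r.1 hr).1 r'.1
    set Ey := (edgeSign (Function.update (Function.update r.1.state x false) z true) y : R)
    set Ex := (edgeSign (Function.update (Function.update r.1.state x false) z true) x : R)
    set Erz := (edgeSign r.1.state z : R)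
    set Epz := (edgeSign (r.1.state ∘ ⇑(Equiv.swap x y)) z : R)
    have eE : (edgeSign (G.toG' hxz ha hb hc hx hy hz r.1 r.2).state z : R) = Epz := by rw [e1]; rfl
    rw [eE] at key
    linear_combination Ey * key + (Erz * Ex * I) * cs - I' * q1 - (Epz * Ey * I) * q2 - (Epz * Ey * I * Ex ^ 2) * q3
  · -- not the matching `ρ`: both sides vanish
    have a1 : (G.aOf hxz ha hb hc hx hy hz r.1 hr).1.state x = false := (G.aOf hxz ha hb hc hx hy hz r.1 hr).2.1
    have a3 : (G.aOf hxz ha hb hc hx hy hz r.1 hr).1.state z = true :=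
      (G.triLoopSq_P hxz ha hb hc hx hy hz _).1 (G.aOf hxz ha hb hc hx hy hz r.1 hr).2.2.2
    have t2' : r'.1.state y = true := t2
    have t1' : r'.1.state x = false := t1
    have hI : G.incidence R hR tR (G.aOf hxz ha hb hc hx hy hz r.1 hr).1 r'.1 = 0 := by
      apply G.incidence_of_not_flip R hR tR
      rintro ⟨j, hj, hs⟩
      by_cases hjy : j = y
      · subst hjy; exact hρ hs
      · have := congrFun hs y
        rw [t2', Function.update_of_ne (fun h ↦ hjy h.symm)] at this
        exact Bool.noConfusion (this.trans (G.aOf hxz ha hb hc hx hy hz r.1 hr).2.2.1)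
    have hI' : (G.braidMove x y z).incidence R hR tR (G.toG' hxz ha hb hc hx hy hz r.1 r.2)
        (G.toG' hxz ha hb hc hx hy hz r'.1 r'.2) = 0 := by
      apply (G.braidMove x y z).incidence_of_not_flip R hR tR
      rintro ⟨j, hj, hs⟩
      change G.stG x y z (G.toG' hxz ha hb hc hx hy hz r'.1 r'.2) =
        Function.update (G.stG x y z (G.toG' hxz ha hb hc hx hy hz r.1 r.2)) j true at hs
      have hsz : ∀ i, r'.1.state i = Function.update (G.stG x y z (G.toG' hxz ha hb hc hx hy hz r.1 r.2)) j true i :=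
        fun i ↦ by rw [← congrFun hs i]; show _ = (G.toG' hxz ha hb hc hx hy hz r'.1 r'.2).state i; rw [u0]
      have hjz : j = z := by
        by_contra hjz
        have := hsz z
        rw [hr'z, Function.update_apply, if_neg (fun h ↦ hjz h.symm), stG_apply, s3] at this
        exact Bool.noConfusion this
      apply hρ
      funext i
      rw [hsz i, hjz]
      by_cases hiy : i = y
      · rw [hiy, Function.update_self, Function.update_of_ne (G.y_ne_z hc), stG_apply, s2]
      rw [Function.update_of_ne hiy]
      by_cases hiz : i = z
      · rw [hiz, Function.update_self, a3]
      rw [Function.update_of_ne hiz, stG_apply, toG'_state, aOf_state, Function.update_of_ne hiz]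
      by_cases hix : i = x
      · rw [hix, Function.update_self, G.swapSt_x hr.2.2, hr.2.1]
      · rw [Function.update_of_ne hix, G.swapSt_of_ne _ hix hiy]
    rw [hI, hI']; ring

end CrossB


section CrossA

variable (G : GaussDiagram) {x y z : Fin G.n}
variable (hxz : x ≠ z) (ha : (G.overPos y : ℕ) = G.overPos x + 1) (hb : (G.overPos z : ℕ) = G.underPos x + 1)
  (hc : (G.underPos z : ℕ) = G.underPos y + 1) (hx : G.sign x = 1) (hy : G.sign y = 1) (hz : G.sign z = 1)
variable {R : Type} [CommRing R] (hR tR : R)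

include hxz ha hb hc hx hy hz in
/-- **The cross block from a `(0, 1, 0)` rest state corresponds under the move**: on `G` it is
the plain `z`-saddle, on the rearrangement the correction term through the loop sector ((*) of
the notes). [cite: Khovanov2000, §5.4] -/
theorem loopM_cross_a (r r' : (G.triLoopSq hxz ha hb hc hx hy hz).XR)
    (hr : r.1.state x = false ∧ r.1.state y = true ∧ r.1.state z = false) (hr'z : r'.1.state z = true) :
    (G.triLoopSq' hxz ha hb hc hx hy hz).loopM hR tR (G.restEquiv hxz ha hb hc hx hy hz r) (G.restEquiv hxz ha hb hc hx hy hz r') =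
      (G.gauge x y z r.1.state : R) * (G.gauge x y z r'.1.state : R) * (G.triLoopSq hxz ha hb hc hx hy hz).loopM hR tR r r' := by
  obtain ⟨t1, t2⟩ := G.bits_of_rest_z r'.2 hr'z
  have t1' : r'.1.state x = false := t1
  have t2' : r'.1.state y = true := t2
  have h₂ := G.bits_toG'_010 hxz ha hb hc hx hy hz r.1 hr r.2
  have u0 : (G.toG' hxz ha hb hc hx hy hz r'.1 r'.2).state = r'.1.state := by rw [toG'_state, G.swapSt_of_z hr'z]
  have u1 : (G.toG' hxz ha hb hc hx hy hz r'.1 r'.2).state x = false := by rw [u0]; exact t1'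
  rw [loopM_tri, loopM_tri']
  simp only [restEquiv_apply]
  rw [G.sum_eq_zero_of_y_G hxz ha hb hc hx hy hz hR tR _ _ hr.2.1, sub_zero,
    incidence_eq_zero_of_state_true_false (H := G.braidMove x y z) hR tR x h₂.1 u1, zero_sub,
    G.sum_zsplit_G' hxz ha hb hc hx hy hz hR tR _ h₂]
  have hg : (G.gauge x y z r.1.state : R) = koszulXY x y r.1.state := by
    unfold gauge; rw [hr.2.2]; simp
  have hg' : (G.gauge x y z r'.1.state : R) = -1 := by unfold gauge; rw [hr'z]; simp
  rw [hg, hg']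
  set a₂ := G.aOf' hxz ha hb hc hx hy hz (G.toG' hxz ha hb hc hx hy hz r.1 r.2) h₂ with ha₂
  by_cases hρ : r'.1.state = Function.update r.1.state z true
  · have key := G.transport_cross_a hxz ha hb hc hx hy hz hR tR r.1 r'.1 hr r.2 r'.2 hρ
    rw [← ha₂] at key
    -- the sign identity, read at `σ = stG (toG' r)` (a `(1,0,0)` state with `σ ∘ π = r`)
    have e1 : G.stG x y z (G.toG' hxz ha hb hc hx hy hz r.1 r.2) = r.1.state ∘ Equiv.swap x y := by
      show G.swapSt x y z r.1.state = _
      rw [G.swapSt_of_not_z (by rw [hr.2.2]; exact Bool.false_ne_true)]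
    have cs0 := cross_sign (G.x_ne_y ha) hxz (G.y_ne_z hc) (G.stG x y z (G.toG' hxz ha hb hc hx hy hz r.1 r.2)) h₂.1 h₂.2.1 h₂.2.2
    rw [← aOf'_state G hxz ha hb hc hx hy hz _ h₂, ← ha₂] at cs0
    rw [show (G.stG x y z (G.toG' hxz ha hb hc hx hy hz r.1 r.2) ∘ ⇑(Equiv.swap x y)) = r.1.state by
      rw [e1]; exact G.comp_swap_comp_swap r.1.state] at cs0
    rw [show koszulXY x y (G.stG x y z (G.toG' hxz ha hb hc hx hy hz r.1 r.2)) = koszulXY x y r.1.state by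
      rw [e1]; exact G.koszulXY_comp_swap r.1.state] at cs0
    have cs := congrArg (Int.cast : ℤ → R) cs0
    push_cast at cs
    have q1 := Transfer.edgeSign_mul_self (R := R) a₂.1.state y
    have q3 := Transfer.edgeSign_mul_self (R := R) r.1.state z
    set I' := (G.braidMove x y z).incidence R hR tR a₂.1 (G.toG' hxz ha hb hc hx hy hz r'.1 r'.2)
    set I := G.incidence R hR tR r.1 r'.1
    set Ey := (edgeSign a₂.1.state y : R)
    set Ex := (edgeSign a₂.1.state x : R)
    set Erz := (edgeSign r.1.state z : R)
    set Esz := (edgeSign (G.stG x y z (G.toG' hxz ha hb hc hx hy hz r.1 r.2)) z : R)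
    have eE : (edgeSign (G.toG' hxz ha hb hc hx hy hz r.1 r.2).state z : R) = Esz := rfl
    rw [eE]
    have cs' : Ex * Esz * Erz * Ey = (koszulXY x y r.1.state : R) := cs
    -- goal: `-(Esz * Ex * I') = κ * (-1) * I`, with `I' * Erz = Ey * I` and `Ex * Esz * Erz * Ey = κ`
    linear_combination (-(Esz * Ex * Erz)) * key - I * cs' + (Esz * Ex * I') * q3
  · -- not the matching `ρ`: both sides vanish
    have hI : G.incidence R hR tR r.1 r'.1 = 0 := by
      apply G.incidence_of_not_flip R hR tR
      rintro ⟨j, hj, hs⟩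
      by_cases hjz : j = z
      · subst hjz; exact hρ hs
      · have := congrFun hs z
        rw [hr'z, Function.update_of_ne (fun h ↦ hjz h.symm), hr.2.2] at this
        exact Bool.noConfusion this
    have hI' : (G.braidMove x y z).incidence R hR tR a₂.1 (G.toG' hxz ha hb hc hx hy hz r'.1 r'.2) = 0 := by
      apply (G.braidMove x y z).incidence_of_not_flip R hR tR
      rintro ⟨j, hj, hs⟩
      change G.stG x y z (G.toG' hxz ha hb hc hx hy hz r'.1 r'.2) = Function.update (G.stG x y z a₂.1) j true at hs
      have hsz : ∀ i, r'.1.state i = Function.update (G.stG x y z a₂.1) j true i :=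
        fun i ↦ by rw [← congrFun hs i]; show _ = (G.toG' hxz ha hb hc hx hy hz r'.1 r'.2).state i; rw [u0]
      have hjy : j = y := by
        by_contra hjy
        have := hsz y
        rw [t2', Function.update_apply, if_neg (fun h ↦ hjy h.symm), stG_apply] at this
        have hay : a₂.1.state y = false := a₂.2.2.1
        exact Bool.noConfusion (this.trans hay)
      apply hρ
      funext i
      by_cases hiz : i = z
      · rw [hiz, Function.update_self, hr'z]
      rw [Function.update_of_ne hiz]
      by_cases hiy : i = y
      · rw [hiy, t2', hr.2.1]
      by_cases hix : i = x
      · rw [hix, t1', hr.1]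
      rw [hsz i, hjy, Function.update_of_ne hiy, stG_apply, ha₂, aOf'_state, Function.update_of_ne hiz,
        Function.update_of_ne hix, stG_apply, toG'_state, G.swapSt_of_ne _ hix hiy]
    rw [hI, hI']; ring

end CrossA


section Master

variable (G : GaussDiagram) {x y z : Fin G.n}
variable (hxz : x ≠ z) (ha : (G.overPos y : ℕ) = G.overPos x + 1) (hb : (G.overPos z : ℕ) = G.underPos x + 1)
  (hc : (G.underPos z : ℕ) = G.underPos y + 1) (hx : G.sign x = 1) (hy : G.sign y = 1) (hz : G.sign z = 1)
variable {R : Type} [CommRing R] (hR tR : R)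

include hxz ha hb hc hx hy hz in
/-- The plain entries of the rests correspond up to the gauge, in the same layer. [folklore] -/
theorem incidence_toG'_layer (r r' : (G.triLoopSq hxz ha hb hc hx hy hz).XR) (hzz : r.1.state z = r'.1.state z) :
    (G.braidMove x y z).incidence R hR tR (G.toG' hxz ha hb hc hx hy hz r.1 r.2) (G.toG' hxz ha hb hc hx hy hz r'.1 r'.2) =
      (G.gauge x y z r.1.state : R) * (G.gauge x y z r'.1.state : R) * G.incidence R hR tR r.1 r'.1 := by
  by_cases hfl : ∃ j, r.1.state j = false ∧ r'.1.state = Function.update r.1.state j true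
  · obtain ⟨j, hj, hs⟩ := hfl
    have hjz : j ≠ z := by
      rintro rfl
      have := congrFun hs j
      rw [Function.update_self, ← hzz, hj] at this
      exact Bool.noConfusion this
    exact G.incidence_toG'_eq_gauge hxz ha hb hc hx hy hz hR tR r.1 r'.1 r.2 r'.2 hjz hj hs
  · rw [G.incidence_of_not_flip R hR tR hfl,
      (G.braidMove x y z).incidence_of_not_flip R hR tR (G.not_flip_toG' hxz ha hb hc hx hy hz r.1 r'.1 r.2 r'.2 hzz hfl),
      mul_zero]

include hxz ha hb hc hx hy hz in
/-- **The reduced differentials of the two sides of the third move correspond under `restEquiv`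
up to the gauge.** Khovanov (2000), §5.4; Bar-Natan (2002), §4.4. [cite: Khovanov2000, §5.4] -/
theorem loopM_restEquiv (r r' : (G.triLoopSq hxz ha hb hc hx hy hz).XR) :
    (G.triLoopSq' hxz ha hb hc hx hy hz).loopM hR tR (G.restEquiv hxz ha hb hc hx hy hz r) (G.restEquiv hxz ha hb hc hx hy hz r') =
      (G.gauge x y z r.1.state : R) * (G.gauge x y z r'.1.state : R) * (G.triLoopSq hxz ha hb hc hx hy hz).loopM hR tR r r' := by
  cases hrz : r.1.state z
  · cases hr'z : r'.1.state z
    · -- both in the layer `z = 0`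
      rw [loopM_tri, loopM_tri']
      simp only [restEquiv_apply]
      rw [G.sum_eq_zero_of_z_G hxz ha hb hc hx hy hz hR tR _ _ hr'z,
        G.sum_eq_zero_of_z_G' hxz ha hb hc hx hy hz hR tR _ _ (by rw [toG'_state, G.swapSt_z hxz hc, hr'z]),
        sub_zero, sub_zero]
      exact G.incidence_toG'_layer hxz ha hb hc hx hy hz hR tR r r' (by rw [hrz, hr'z])
    · -- the cross blocks
      cases hrx : r.1.state x <;> cases hry : r.1.state y
      · -- `(0,0,0)`: everything vanishes
        obtain ⟨t1, t2⟩ := G.bits_of_rest_z r'.2 hr'z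
        rw [loopM_tri, loopM_tri']
        simp only [restEquiv_apply]
        have s1 : (G.toG' hxz ha hb hc hx hy hz r.1 r.2).state x = false := by rw [toG'_state, G.swapSt_x hrz, hry]
        have s3 : (G.toG' hxz ha hb hc hx hy hz r.1 r.2).state z = false := by rw [toG'_state, G.swapSt_z hxz hc, hrz]
        have u2 : (G.toG' hxz ha hb hc hx hy hz r'.1 r'.2).state y = true := by rw [toG'_state, G.swapSt_of_z hr'z]; exact t2
        have u3 : (G.toG' hxz ha hb hc hx hy hz r'.1 r'.2).state z = true := by rw [toG'_state, G.swapSt_of_z hr'z]; exact hr'z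
        have s2 : (G.toG' hxz ha hb hc hx hy hz r.1 r.2).state y = false := by rw [toG'_state, G.swapSt_y hrz, hrx]
        rw [G.sum_eq_zero_of_000_G hxz ha hb hc hx hy hz hR tR _ _ hrx hrz,
          G.sum_eq_zero_of_000_G' hxz ha hb hc hx hy hz hR tR _ _ s1 s3,
          incidence_eq_zero_of_two hR tR (G.y_ne_z hc) hry t2 hrz hr'z,
          incidence_eq_zero_of_two (K := G.braidMove x y z) hR tR (G.y_ne_z hc) s2 u2 s3 u3]
        ring
      · exact G.loopM_cross_a hxz ha hb hc hx hy hz hR tR r r' ⟨hrx, hry, hrz⟩ hr'z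
      · exact G.loopM_cross_b hxz ha hb hc hx hy hz hR tR r r' ⟨hrx, hry, hrz⟩ hr'z
      · -- `(1,1,0)`: everything vanishes
        obtain ⟨t1, t2⟩ := G.bits_of_rest_z r'.2 hr'z
        rw [loopM_tri, loopM_tri']
        simp only [restEquiv_apply]
        have s2 : (G.toG' hxz ha hb hc hx hy hz r.1 r.2).state y = true := by rw [toG'_state, G.swapSt_y hrz, hrx]
        have s1 : (G.toG' hxz ha hb hc hx hy hz r.1 r.2).state x = true := by rw [toG'_state, G.swapSt_x hrz, hry]
        have u1 : (G.toG' hxz ha hb hc hx hy hz r'.1 r'.2).state x = false := by rw [toG'_state, G.swapSt_of_z hr'z]; exact t1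
        rw [G.sum_eq_zero_of_y_G hxz ha hb hc hx hy hz hR tR _ _ hry,
          G.sum_eq_zero_of_y_G' hxz ha hb hc hx hy hz hR tR _ _ s2,
          incidence_eq_zero_of_state_true_false hR tR x hrx t1,
          incidence_eq_zero_of_state_true_false (H := G.braidMove x y z) hR tR x s1 u1]
        ring
  · -- `r` in the sector `D₁`
    obtain ⟨r1, r2⟩ := G.bits_of_rest_z r.2 hrz
    rw [loopM_tri, loopM_tri']
    simp only [restEquiv_apply]
    have s2 : (G.toG' hxz ha hb hc hx hy hz r.1 r.2).state y = true := by rw [toG'_state, G.swapSt_of_z hrz]; exact r2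
    rw [G.sum_eq_zero_of_y_G hxz ha hb hc hx hy hz hR tR _ _ r2, G.sum_eq_zero_of_y_G' hxz ha hb hc hx hy hz hR tR _ _ s2,
      sub_zero, sub_zero]
    cases hr'z : r'.1.state z
    · have s3 : (G.toG' hxz ha hb hc hx hy hz r.1 r.2).state z = true := by rw [toG'_state, G.swapSt_of_z hrz]; exact hrz
      have u3 : (G.toG' hxz ha hb hc hx hy hz r'.1 r'.2).state z = false := by rw [toG'_state, G.swapSt_z hxz hc, hr'z]
      rw [incidence_eq_zero_of_state_true_false hR tR z hrz hr'z,
        incidence_eq_zero_of_state_true_false (H := G.braidMove x y z) hR tR z s3 u3, mul_zero]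
    · exact G.incidence_toG'_layer hxz ha hb hc hx hy hz hR tR r r' (by rw [hrz, hr'z])

end Master

end GaussDiagram

end Literature.Topology.FourManifolds
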